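import Literature.Probability.FitznerVanDerHofstad2017.MeanFieldD11Inputs
import Literature.Probability.FitznerVanDerHofstad2017.NobleKSpaceRewritePhi
import HarnessLib

/-!
# `d = 11`: the certificate on the KERNEL-PROVED Appendix-D line — regime and sign side conditions
# checked from the certified table, and the mean-field sentence without the hybrid leaf

CITATION HEADER (PLACEMENT v2). This module is part of a certified REPRODUCTION of:
R. Fitzner, R. van der Hofstad, *Mean-field behavior for nearest-neighbor percolation in d > 10*,
Electron. J. Probab. 22 (2017), no. 43, 1–65 [FvdH17], and *Generalized approach to the non-backtracking
lace expansion*, Probab. Theory Related Fields 169 (2017), 1041–1119 [NoBLE17] (arXiv:1506.07977, 1506.07969).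
Reproduces: the per-dimension form of [NoBLE17] Prop. 4.5(ii) / App. D at `d = 11` on the typed kernel line of
`NobleKSpaceRewrite.lean` / `NobleKSpaceRewritePhi.lean`, and its assembly with `MeanFieldD11Inputs.lean`.
Origin: build `lace`, staging package `LaceExpansionHighD` (seat lean2, generation 13).

ROLE OF THIS MODULE (ADDITIVE; the certificate of record `MeanFieldD11Cert` revision 6, its input-level twin
`MeanFieldD11Inputs` revision 6, and the oracle binders `NobleImprovementInputsAt` / `NobleInitialInputsAt` of
`NobleInstantiate` are UNCHANGED and not re-cut).  The analytic half of [NoBLE17] Prop. 4.5(ii) is now a chain of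
tree THEOREMS: the `k`-space rewrite with App. D Steps 3–4 (`nobleSimplifiedFormAt_of_assumptions`, module
`NobleKSpaceRewrite`), App. D Steps 1–2 for `Φ` with the constants `c_Φ`, `α_Φ`, `R_Φ` constructed and (D.2), (D.4),
(D.14) proved against the wired `β`-table `BetaMap.nobleBetaOfInputs` (`nobleSimplifiedFormAt_percolation`, module
`NobleKSpaceRewritePhi`), Assumption 4.1 / 4.2 and the shifted-sum symmetry for the percolation split
(`NoblePercolationSplit`), the `x`-space NoBLE equations from `N`-summability (`percolationNobleEquationAt_of_summable`,
module `NobleIdentity`) and `p_I < p_c` (`NobleInitialPoint`).  What that chain asks of the INPUT NUMERALS, besides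
Assumption 4.3 itself, are the decidable regime and sign side conditions of App. D:

* `NobleInputsWF d i` — every Assumption-4.3 constant `≥ 0`, `0 ≤ μ < 1`, `0 ≤ β̲_μ < 1`, the geometric ratio
  `2d·μ̄/(1−μ)·β^abs_{Ξ^ι} < 1` of (D.21)/(D.29)/(D.32), and the printed `β_μ ≥ 1`, `β̲_μ > 0` of (4.30);
* (N1') `0 ≤ c̲_Φ(i) = betaCPhiLow` ((D.2), lower member; gives `0 ≤ c_Φ`);
* (N2) `β^abs_Ξ + β^abs_{Ξ^ι} < 1` (invertibility of the rewrite, in place of the print's `c_Φ − β_{α,Φ} − β_{R,Φ} > 0`);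
* (N3) `β_Ψ̂(i) < 1` ((D.5), sign of the `Ψ̂`-denominator).

This module KERNEL-CHECKS all of them (`norm_num`, exact rational arithmetic) at BOTH stages of the certified input
table of `MeanFieldD11Inputs` (`D11.inputsI`, `D11.inputsO`; tuple O12g, cell of record): `inputsI_WF`, `inputsO_WF`,
`n1_inputsI/O`, `n2_inputsI/O`, `n3_inputsI/O` — values `c̲_Φ = 0.99709 (i) / 0.99694 (o)`, `β^abs_Ξ + β^abs_{Ξ^ι} =
0.01930 (i) / 0.02191 (o)`, `β_Ψ̂ = 0.004465 (i) / 0.005815 (o)`, ratio `0.00378 (i) / 0.00415 (o)` — which is the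
precondition HOME/REFEREE.md C44 (R267) puts on any use of the kernel App.-D line with the certified table.  It then
INSTANTIATES the kernel line at `d = 11`: `nobleSimplifiedFormAt_d11_o` (improvement stage, any `0 < p < p_c`) and
`nobleSimplifiedFormAt_d11_i` (initial point `p_I = 1/21`), and re-derives the `d = 11` sentence of `MeanFieldD11Inputs`
(`meanField_d11_inputs`, unchanged) with its two oracle binders REPLACED by typed, per-`p` hypotheses:
`nobleImprovementInputsAt_d11_appD`, `nobleInitialInputsAt_d11_appD`, `meanField_d11_appD`,
`percolationContinuity_d11_appD`.

HONEST LABEL (REFEREE V1(b); ABSOLUTE RULE).  NO named fact is consumed: the hybrid leaf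
`FitznerVanDerHofstad2016NoBLE_prop45ii` and its printed twin are NOT used.  The hypotheses that REMAIN are typed
statements about percolation on `ℤ^11`, ANALYTIC / NUMERICAL and NOT CITABLE as typed (their constants are the
programme's certified numerals, HOME/GAPS.md G8):
(S2a) Assumption 4.3 at `p` for the percolation split of [FvdH17] §3 with the constants `D11.inputsO` — for every
`p ∈ (p_I, p_c)` at which `f_j(p) ≤ Γ_j` — and with `D11.inputsI` at `p_I` ([FvdH17] §§4–6: the diagrammatic bounds,
STEP 2 of the build); (S2b) the weighted-diagram bounds `NobleWeightedDiagramBoundAt 11 p bo` / `… p_I bi` ([FvdH17]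
Prop. 2.2); (F) the ONE remaining analytic statement of App. D on this line, NAMED: the `F`-side dispersive bound
`(α̲_F − β_{ΔR,F})(1 − D̂(k)) ≤ F̂_p(0) − F̂_p(k)` on `(−π,π]^11`, i.e. (D.3) (Step 1, the lower enclosure of `α_F`) combined
with (D.32) (Step 5) — hypothesis `hF` of `nobleSimplifiedFormAt_percolation`, neither cited nor proved here.
Value = the `d = 11` certificate sentence on the kernel App.-D line with its residual analytic content EXPLICIT and
typed per `p`; not summit progress, no new numeral, no sentence about any other dimension.

[cite: FitznerVanDerHofstad2016NoBLE, Assumption 4.3 (4.30) and "β^{(N)}_• ≥ 0" (p. 1086); Prop. 4.5 (p. 1088);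
App. D Step 1 (D.1)–(D.5) (pp. 1110–1111), Step 2 (D.9)–(D.14) (pp. 1112–1113), (D.21), (D.29), (D.32) (pp. 1114–1118)]
[cite: FitznerVanDerHofstad2017, Thm 1.1 / Cor. 1.3 and §2.5, Figure 3 (d = 11); Prop. 2.1, Prop. 2.2 (EJP pp. 10–11)]
-/

noncomputable section

namespace Literature.Probability.FitznerVanDerHofstad2017
namespace D11

open _root_.MeasureTheory _root_.Filter _root_.Topology Literature.Probability.LatticeModels
open Literature.Barriers.CriticalPhenomena Literature.Probability.Percolation

/-! ## The App.-D regime and sign side conditions at the certified input table, kernel-checked -/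

/-- `2 ≤ 11`: the standing dimension hypothesis of the kernel App.-D line at `d = 11`. [folklore] -/
theorem two_le_eleven : 2 ≤ 11 := by norm_num

/-- Every Assumption-4.3-type constant of the INITIAL-stage table `inputsI` is `≥ 0` (and `β̲_μ < 1`), kernel-checked.
[cite: FitznerVanDerHofstad2016NoBLE, Assumption 4.3, "β^{(N)}_• ≥ 0" (p. 1086)] -/
theorem inputsI_nonneg : BetaMap.Inputs.Nonneg inputsI := by
  constructor <;> norm_num [inputsI]

/-- Every Assumption-4.3-type constant of the IMPROVEMENT-stage table `inputsO` is `≥ 0` (and `β̲_μ < 1`), kernel-checked.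
[cite: FitznerVanDerHofstad2016NoBLE, Assumption 4.3, "β^{(N)}_• ≥ 0" (p. 1086)] -/
theorem inputsO_nonneg : BetaMap.Inputs.Nonneg inputsO := by
  constructor <;> norm_num [inputsO]

/-- **The App.-D regime at the INITIAL-stage certified table**: `NobleInputsWF 11 inputsI` — signs, `0 ≤ μ < 1`,
`0 ≤ β̲_μ`, the geometric ratio `2d·μ̄/(1−μ)·β^abs_{Ξ^ι} = 0.00378 < 1`, `β_μ = 1.002756… ≥ 1`, `β̲_μ = 0.04748… > 0`;
kernel-checked from the numerals of `MeanFieldD11Inputs`.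
[cite: FitznerVanDerHofstad2016NoBLE, Assumption 4.3 (4.30) (p. 1086); App. D (D.21), (D.29), (D.32) (pp. 1114–1118)] -/
theorem inputsI_WF : NobleInputsWF 11 inputsI :=
  ⟨⟨inputsI_nonneg, by norm_num [inputsI], by norm_num [inputsI], by norm_num [inputsI], by norm_num [inputsI]⟩,
    by norm_num [inputsI], by norm_num [inputsI]⟩

/-- **The App.-D regime at the IMPROVEMENT-stage certified table**: `NobleInputsWF 11 inputsO` (ratio `0.00415 < 1`,
`β_μ = 1.002897… ≥ 1`, `β̲_μ = 0.04748… > 0`); kernel-checked.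
[cite: FitznerVanDerHofstad2016NoBLE, Assumption 4.3 (4.30) (p. 1086); App. D (D.21), (D.29), (D.32) (pp. 1114–1118)] -/
theorem inputsO_WF : NobleInputsWF 11 inputsO :=
  ⟨⟨inputsO_nonneg, by norm_num [inputsO], by norm_num [inputsO], by norm_num [inputsO], by norm_num [inputsO]⟩,
    by norm_num [inputsO], by norm_num [inputsO]⟩

/-- (N1') at the initial-stage table: `0 ≤ c̲_Φ(inputsI)` (= `0.99708…`), the lower member of (D.2), kernel-checked.
[cite: FitznerVanDerHofstad2016NoBLE, App. D (D.2) (p. 1110)] -/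
theorem n1_inputsI :
    0 ≤ BetaMap.betaCPhiLow ((11 : ℕ) : ℝ) inputsI.mu inputsI.xiAlphaOneMinusZeroAtZero inputsI.xiIotaAlphaIAtEi := by
  norm_num [BetaMap.betaCPhiLow, inputsI]

/-- (N1') at the improvement-stage table: `0 ≤ c̲_Φ(inputsO)` (= `0.99693…`), kernel-checked.
[cite: FitznerVanDerHofstad2016NoBLE, App. D (D.2) (p. 1110)] -/
theorem n1_inputsO :
    0 ≤ BetaMap.betaCPhiLow ((11 : ℕ) : ℝ) inputsO.mu inputsO.xiAlphaOneMinusZeroAtZero inputsO.xiIotaAlphaIAtEi := by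
  norm_num [BetaMap.betaCPhiLow, inputsO]

/-- (N2) at the initial-stage table: `β^abs_Ξ + β^abs_{Ξ^ι} = 0.01929… < 1`, kernel-checked (REFEREE C44).
[cite: FitznerVanDerHofstad2016NoBLE, Assumption 4.3 (4.31), (4.49) (pp. 1086–1088)] -/
theorem n2_inputsI : inputsI.xiAbs + inputsI.xiIotaAbs < 1 := by norm_num [inputsI]

/-- (N2) at the improvement-stage table: `β^abs_Ξ + β^abs_{Ξ^ι} = 0.02191… < 1`, kernel-checked (REFEREE C44).
[cite: FitznerVanDerHofstad2016NoBLE, Assumption 4.3 (4.31), (4.49) (pp. 1086–1088)] -/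
theorem n2_inputsO : inputsO.xiAbs + inputsO.xiIotaAbs < 1 := by norm_num [inputsO]

/-- (N3) at the initial-stage table: `β_Ψ̂(inputsI) = 0.004464… < 1` ((D.5) as wired, factor `(2d−1)/(2d)·β_μ`),
kernel-checked (REFEREE C44). [cite: FitznerVanDerHofstad2016NoBLE, App. D (D.5) (p. 1111)] -/
theorem n3_inputsI : (BetaMap.nobleBetaOfInputs ((11 : ℕ) : ℝ) inputsI).βΨ < 1 := by
  norm_num [BetaMap.nobleBetaOfInputs, BetaMap.betaPsiHatLower, inputsI]

/-- (N3) at the improvement-stage table: `β_Ψ̂(inputsO) = 0.005815… < 1`, kernel-checked (REFEREE C44).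
[cite: FitznerVanDerHofstad2016NoBLE, App. D (D.5) (p. 1111)] -/
theorem n3_inputsO : (BetaMap.nobleBetaOfInputs ((11 : ℕ) : ℝ) inputsO).βΨ < 1 := by
  norm_num [BetaMap.nobleBetaOfInputs, BetaMap.betaPsiHatLower, inputsO]

/-- (N3) at the QUOTED Assumption-2.7 tables of the certificate of record `MeanFieldD11Cert` (`Bi`, `Bo`, engine-A
values): `β_Ψ̂ = 0.004464… (i)`, `0.005815… (o) < 1`, kernel-checked (REFEREE C44; the kernel App.-D line itself uses the
`β`-table computed from the inputs, `n3_inputsI/O`). [cite: FitznerVanDerHofstad2016NoBLE, App. D (D.5) (p. 1111); Assumption 2.7 (pp. 1059–1060)] -/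
theorem cert_betaPsi_lt_one : Bi.βΨ < 1 ∧ Bo.βΨ < 1 := by
  constructor <;> norm_num [Bi, Bo]

/-! ## The kernel App.-D line instantiated at `d = 11` -/

/-- **[NoBLE17] Prop. 4.5(ii) at `d = 11`, IMPROVEMENT stage, on the kernel line.**  For `0 < p < p_c(11)`: if
Assumption 4.3 holds at `p` for the percolation split with the certified constants `inputsO` (hypothesis `h43`,
STEP 2 — analytic, not citable) and the `F`-side dispersive bound (D.3)+(D.32) holds at `p` (hypothesis `hF` — the one
remaining analytic statement of App. D on this line), then `τ̂_p` has the simplified NoBLE form with the β-table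
`nobleBetaOfInputs 11 inputsO`.  DISCHARGED BY THE KERNEL: the regime `NobleInputsWF` and (N1'), (N2), (N3)
(this module), the NoBLE equations at `p` (`percolationNobleEquationAt_of_summable` from the `NSumLE` clauses of `h43`),
Assumption 4.1 and the shifted-sum symmetry (`nobleSimplifiedFormAt_percolation`), App. D Steps 1–2 (Φ) and 3–4.
[cite: FitznerVanDerHofstad2016NoBLE, Prop. 4.5 (p. 1088); App. D (pp. 1110–1118)]
[cite: FitznerVanDerHofstad2017, Prop. 2.1 (EJP p. 10); §2.5 (d = 11)] -/
theorem nobleSimplifiedFormAt_d11_o {p : unitInterval} (hp : p < criticalProbI 11) (hp0 : 0 < (p : ℝ))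
    (h43 : NobleAssumption43At 11 p (percolationNobleSplit 11 p two_le_eleven hp) inputsO)
    (hF : ∀ k ∈ cube 11,
      ((BetaMap.nobleBetaOfInputs ((11 : ℕ) : ℝ) inputsO).αFlow - (BetaMap.nobleBetaOfInputs ((11 : ℕ) : ℝ) inputsO).βΔ) *
        (1 - Dhat 11 k) ≤ cosFT (nobleF 11 p) 0 - cosFT (nobleF 11 p) k) :
    NobleSimplifiedFormAt 11 p (BetaMap.nobleBetaOfInputs ((11 : ℕ) : ℝ) inputsO) :=
  nobleSimplifiedFormAt_percolation two_le_eleven hp hp0 inputsO_WF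
    (percolationNobleEquationAt_of_summable two_le_eleven hp hp0 h43.xiAbs.2.1 fun ι => (h43.xiIotaAbs ι).2.1)
    h43 n1_inputsO n2_inputsO n3_inputsO hF

/-- **[NoBLE17] Prop. 4.5(ii) at `d = 11`, INITIAL point `p_I = 1/21`, on the kernel line** (as
`nobleSimplifiedFormAt_d11_o`, constants `inputsI`; `0 < p_I < p_c(11)` are the theorems `nbwThresholdI_pos`,
`nbwThresholdI_lt_criticalProbI`).
[cite: FitznerVanDerHofstad2016NoBLE, Prop. 4.5 (p. 1088); Assumption 4.3, closing sentence (p. 1088: the bounds at z = z_I); App. D (pp. 1110–1118)]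
[cite: FitznerVanDerHofstad2017, §2.4 (p_I = 1/(2d−1)); §2.5 (d = 11)] -/
theorem nobleSimplifiedFormAt_d11_i
    (h43 : NobleAssumption43At 11 (nbwThresholdI 11)
      (percolationNobleSplit 11 (nbwThresholdI 11) two_le_eleven (nbwThresholdI_lt_criticalProbI two_le_eleven)) inputsI)
    (hF : ∀ k ∈ cube 11,
      ((BetaMap.nobleBetaOfInputs ((11 : ℕ) : ℝ) inputsI).αFlow - (BetaMap.nobleBetaOfInputs ((11 : ℕ) : ℝ) inputsI).βΔ) *
        (1 - Dhat 11 k) ≤ cosFT (nobleF 11 (nbwThresholdI 11)) 0 - cosFT (nobleF 11 (nbwThresholdI 11)) k) :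
    NobleSimplifiedFormAt 11 (nbwThresholdI 11) (BetaMap.nobleBetaOfInputs ((11 : ℕ) : ℝ) inputsI) :=
  have hp := nbwThresholdI_lt_criticalProbI two_le_eleven
  have hp0 : 0 < ((nbwThresholdI 11 : unitInterval) : ℝ) := nbwThresholdI_pos (by norm_num)
  nobleSimplifiedFormAt_percolation two_le_eleven hp hp0 inputsI_WF
    (percolationNobleEquationAt_of_summable two_le_eleven hp hp0 h43.xiAbs.2.1 fun ι => (h43.xiIotaAbs ι).2.1)
    h43 n1_inputsI n2_inputsI n3_inputsI hF

/-! ## The `d = 11` sentence on the kernel App.-D line -/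

/-- **The improvement-step oracle binder at `d = 11` from the kernel App.-D line.**  Hypothesis `h`: for every
`p ∈ (p_I, p_c)` at which the bootstrap bounds `f_j(p) ≤ Γ_j` hold (the `Γ` of `MeanFieldD11Cert`), (S2a) Assumption 4.3
at `p` for the percolation split with the certified constants `inputsO`, (F) the `F`-side dispersive bound (D.3)+(D.32)
at `p`, and (S2b) the weighted-diagram bounds `bo` ([FvdH17] Prop. 2.2) — all ANALYTIC / NUMERICAL, NOT CITABLE as
typed.  Conclusion: the binder `NobleImprovementInputsAt 11 c_μ c Γ (β(inputsO)) bo` of the unchanged `d = 11`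
certificate `meanField_d11_inputs`.  No named fact is used.
[cite: FitznerVanDerHofstad2016NoBLE, Prop. 4.5 (p. 1088); App. D (pp. 1110–1118); Prop. 2.11 (p. 1061)]
[cite: FitznerVanDerHofstad2017, Prop. 2.2 (EJP p. 11); §2.5 (d = 11)] -/
theorem nobleImprovementInputsAt_d11_appD
    (h : ∀ (p : unitInterval) (hp : p ∈ Set.Ioo (nbwThresholdI 11) (criticalProbI 11)),
      (∀ j, Literature.Barriers.CriticalPhenomena.nobleF 11 cMuC cWeightsC j p ≤ GammaC j) →
        NobleAssumption43At 11 p (percolationNobleSplit 11 p two_le_eleven hp.2) inputsO ∧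
        (∀ k ∈ cube 11,
          ((BetaMap.nobleBetaOfInputs ((11 : ℕ) : ℝ) inputsO).αFlow -
              (BetaMap.nobleBetaOfInputs ((11 : ℕ) : ℝ) inputsO).βΔ) * (1 - Dhat 11 k) ≤
            cosFT (nobleF 11 p) 0 - cosFT (nobleF 11 p) k) ∧
        NobleWeightedDiagramBoundAt 11 p bo) :
    NobleImprovementInputsAt 11 cMuC cWeightsC GammaC (BetaMap.nobleBetaOfInputs 11 inputsO) bo := by
  intro p hp hΓ
  obtain ⟨h43, hF, hW⟩ := h p hp hΓ
  have hp0 : 0 < (p : ℝ) :=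
    lt_trans (nbwThresholdI_pos (by norm_num)) (show ((nbwThresholdI 11 : unitInterval) : ℝ) < p by exact_mod_cast hp.1)
  have hS := nobleSimplifiedFormAt_d11_o hp.2 hp0 h43 hF
  simp only [Nat.cast_ofNat] at hS
  exact ⟨hS, hW⟩

/-- **The initial-step oracle binder at `d = 11` from the kernel App.-D line**: Assumption 4.3 at `p_I` for the
percolation split with the certified constants `inputsI` (S2a), the `F`-side dispersive bound at `p_I` (F), and the
weighted-diagram bounds `bi` at `p_I` (S2b) give `NobleInitialInputsAt 11 (β(inputsI)) bi`.  No named fact is used.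
[cite: FitznerVanDerHofstad2016NoBLE, Prop. 4.5 (p. 1088); Assumption 4.3 (p. 1088: z = z_I); Prop. 2.11 (p. 1061: f_i(z_I) ≤ γ_i)]
[cite: FitznerVanDerHofstad2017, Prop. 2.2 (EJP p. 11); §2.4–§2.5] -/
theorem nobleInitialInputsAt_d11_appD
    (h43 : NobleAssumption43At 11 (nbwThresholdI 11)
      (percolationNobleSplit 11 (nbwThresholdI 11) two_le_eleven (nbwThresholdI_lt_criticalProbI two_le_eleven)) inputsI)
    (hF : ∀ k ∈ cube 11,
      ((BetaMap.nobleBetaOfInputs ((11 : ℕ) : ℝ) inputsI).αFlow - (BetaMap.nobleBetaOfInputs ((11 : ℕ) : ℝ) inputsI).βΔ) *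
        (1 - Dhat 11 k) ≤ cosFT (nobleF 11 (nbwThresholdI 11)) 0 - cosFT (nobleF 11 (nbwThresholdI 11)) k)
    (hW : NobleWeightedDiagramBoundAt 11 (nbwThresholdI 11) bi) :
    NobleInitialInputsAt 11 (BetaMap.nobleBetaOfInputs 11 inputsI) bi := by
  have hS := nobleSimplifiedFormAt_d11_i h43 hF
  simp only [Nat.cast_ofNat] at hS
  exact ⟨hS, hW⟩

/-- **Mean-field behaviour at `d = 11` on the kernel App.-D line.**  The `d = 11` certificate sentence of
`MeanFieldD11Inputs` (`meanField_d11_inputs`: the 36 certificate inequalities and the App.-D `β`-map evaluated by the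
kernel, the bootstrap of `LaceBootstrap` / `MeanFieldD11`) with its two oracle binders supplied by
`nobleInitialInputsAt_d11_appD` / `nobleImprovementInputsAt_d11_appD`.  REMAINING HYPOTHESES (ANALYTIC / NUMERICAL,
NOT CITABLE as typed; no named fact, no hybrid leaf): (S2a) Assumption 4.3 for the percolation split with the
certified constants — `inputsI` at `p_I`, `inputsO` on `(p_I, p_c)` under `f ≤ Γ`; (S2b) [FvdH17] Prop. 2.2's
weighted-diagram bounds `bi`, `bo`; (F) App. D (D.3)+(D.32), the `F`-side dispersive bound, at `p_I` and on the window.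
Conclusion: triangle condition, `θ(p_c) = 0`, and `β = 1` in the bounded-ratio form on `ℤ^11`.
[cite: FitznerVanDerHofstad2017, Thm 1.1 / Cor. 1.3 (d = 11: numerical verification re-run with certified arithmetic)]
[cite: FitznerVanDerHofstad2016NoBLE, Thm 2.10, Prop. 2.11, Prop. 4.5, App. D] -/
theorem meanField_d11_appD
    (hI43 : NobleAssumption43At 11 (nbwThresholdI 11)
      (percolationNobleSplit 11 (nbwThresholdI 11) two_le_eleven (nbwThresholdI_lt_criticalProbI two_le_eleven)) inputsI)
    (hIF : ∀ k ∈ cube 11,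
      ((BetaMap.nobleBetaOfInputs ((11 : ℕ) : ℝ) inputsI).αFlow - (BetaMap.nobleBetaOfInputs ((11 : ℕ) : ℝ) inputsI).βΔ) *
        (1 - Dhat 11 k) ≤ cosFT (nobleF 11 (nbwThresholdI 11)) 0 - cosFT (nobleF 11 (nbwThresholdI 11)) k)
    (hIW : NobleWeightedDiagramBoundAt 11 (nbwThresholdI 11) bi)
    (hS : ∀ (p : unitInterval) (hp : p ∈ Set.Ioo (nbwThresholdI 11) (criticalProbI 11)),
      (∀ j, Literature.Barriers.CriticalPhenomena.nobleF 11 cMuC cWeightsC j p ≤ GammaC j) →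
        NobleAssumption43At 11 p (percolationNobleSplit 11 p two_le_eleven hp.2) inputsO ∧
        (∀ k ∈ cube 11,
          ((BetaMap.nobleBetaOfInputs ((11 : ℕ) : ℝ) inputsO).αFlow -
              (BetaMap.nobleBetaOfInputs ((11 : ℕ) : ℝ) inputsO).βΔ) * (1 - Dhat 11 k) ≤
            cosFT (nobleF 11 p) 0 - cosFT (nobleF 11 p) k) ∧
        NobleWeightedDiagramBoundAt 11 p bo) :
    TriangleCondition 11 ∧ PercolationContinuity 11 ∧ BetaEqOneBoundedRatio 11 :=
  meanField_d11_inputs (nobleInitialInputsAt_d11_appD hI43 hIF hIW) (nobleImprovementInputsAt_d11_appD hS)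

/-- `θ(p_c) = 0` on `ℤ^11` on the kernel App.-D line (hypotheses as in `meanField_d11_appD`).
[cite: FitznerVanDerHofstad2017, Cor. 1.3 (d = 11)] -/
theorem percolationContinuity_d11_appD
    (hI43 : NobleAssumption43At 11 (nbwThresholdI 11)
      (percolationNobleSplit 11 (nbwThresholdI 11) two_le_eleven (nbwThresholdI_lt_criticalProbI two_le_eleven)) inputsI)
    (hIF : ∀ k ∈ cube 11,
      ((BetaMap.nobleBetaOfInputs ((11 : ℕ) : ℝ) inputsI).αFlow - (BetaMap.nobleBetaOfInputs ((11 : ℕ) : ℝ) inputsI).βΔ) *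
        (1 - Dhat 11 k) ≤ cosFT (nobleF 11 (nbwThresholdI 11)) 0 - cosFT (nobleF 11 (nbwThresholdI 11)) k)
    (hIW : NobleWeightedDiagramBoundAt 11 (nbwThresholdI 11) bi)
    (hS : ∀ (p : unitInterval) (hp : p ∈ Set.Ioo (nbwThresholdI 11) (criticalProbI 11)),
      (∀ j, Literature.Barriers.CriticalPhenomena.nobleF 11 cMuC cWeightsC j p ≤ GammaC j) →
        NobleAssumption43At 11 p (percolationNobleSplit 11 p two_le_eleven hp.2) inputsO ∧
        (∀ k ∈ cube 11,
          ((BetaMap.nobleBetaOfInputs ((11 : ℕ) : ℝ) inputsO).αFlow -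
              (BetaMap.nobleBetaOfInputs ((11 : ℕ) : ℝ) inputsO).βΔ) * (1 - Dhat 11 k) ≤
            cosFT (nobleF 11 p) 0 - cosFT (nobleF 11 p) k) ∧
        NobleWeightedDiagramBoundAt 11 p bo) :
    PercolationContinuity 11 :=
  (meanField_d11_appD hI43 hIF hIW hS).2.1

end D11
end Literature.Probability.FitznerVanDerHofstad2017

end
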